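import Mathlib.Probability.ProbabilityMassFunction.Constructions
import Mathlib.Probability.Moments.SubGaussian
import Mathlib.Probability.Independence.Basic
import HarnessLib

/-!
# Hoeffding's inequality with arbitrary outcome weights, and the median trick (median of means)

Topic `Literature/Computability/Complexity`; companion of `MajorityVoteWeighted.lean` (weighted
Chebyshev majority vote, `1/(4mη²)`) and `SamplingChernoff.lean` (Hoeffding over UNIFORM trials,
counting form).  This file supplies the two missing combinations, in the same finite "product
weight" language (one trial has finitely many outcomes `a : α` with weights `w a ≥ 0`, `∑ w = 1`;
`m` independent trials are the sequences `ω : Fin m → α` weighted by `∏ᵢ w (ω i)`):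

* **Hoeffding with arbitrary weights** (`sum_weight_upperDeviation_le_exp`,
  `sum_weight_lowerDeviation_le_exp`): for `F : α → [0,1]` with mean `∑ w·F`, the product weight of
  `{ω : ∑ᵢ F(ωᵢ) ≥ m·(∑ w F) + mη}` (resp. `≤ m·(∑ w F) − mη`) is `≤ exp(−2mη²)` — Hoeffding 1963,
  Thm. 1 (eq. (2.3)) / Thm. 2 for `[0,1]`-valued summands;
* **the median trick / powering lemma** (Jerrum–Valiant–Vazirani 1986, Lemma 6.1: run an
  estimator `t` times and output the MEDIAN; if each run fails with probability `≤ 1/4` the median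
  fails with probability exponentially small in `t`), in the Hoeffding form used throughout the
  quantum-inspired ("dequantization") literature — Chia–Gilyén–Li–Lin–Tang–Wang, J. ACM 69 (2022),
  §7, proof of Lemma "Inner product estimation": "we take the (component-wise) median of
  `y := 8 log(1/δ)` independent copies of `Z̄` … if `|Re(Z̃ − E[Z])| ≥ ε/√2`, then at least half of the
  `Z̄`'s satisfy `|Re(Z̄ − E[Z])| ≥ ε/√2` … So, by Hoeffding's inequality,
  `Pr[(1/q)∑ E_i ≥ 1/2] ≤ Pr[(1/q)∑ E_i ≥ 1/4 + E[E_i]] ≤ exp(−q/8) ≤ δ/2`":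
  - `sum_weight_half_bad_le_exp`: bad weight `≤ 1/4` per trial ⇒ the product weight of
    `{ω : at least half of the q trials are bad}` is `≤ exp(−q/8)`;
  - `IsMedian v c` (fewer than half the values strictly below `c`, fewer than half strictly above),
    the key observation `IsMedian.le_two_mul_card_far` (a median at distance `≥ a` from `μ` forces
    at least half the values to be at distance `≥ a`), and existence `exists_isMedian`;
  - `sum_weight_median_far_le_exp`: for ANY median selector, the product weight of
    `{ω : |median − μ| ≥ a}` is `≤ exp(−q/8)`, and `exp_neg_div_eight_le`: `≤ δ` once
    `q ≥ 8 ln(1/δ)`.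

Proof method (as in the two companions): Mathlib's Hoeffding inequality for sums of independent
sub-Gaussian variables (`ProbabilityTheory.HasSubgaussianMGF.measure_sum_ge_le_of_iIndepFun`,
with Hoeffding's lemma `hasSubgaussianMGF_of_mem_Icc`, parameter `1/4`) under the product
(`Measure.pi`) of the one-trial measure `PMF.toMeasure` of the weights; the product measure of a
finite set of sequences is read off `Measure.pi_singleton`.  Inside the proofs the finite outcome
type carries the discrete measurable structure `⊤`; all STATEMENTS are about finite sums.  No named
facts; everything stated is proved.

## References
* W. Hoeffding, *Probability inequalities for sums of bounded random variables*, J. Amer. Statist.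
  Assoc. 58 (1963) 13–30, Thm. 1 (eq. (2.3)) and Thm. 2 [Hoeffding1963].
* M. R. Jerrum, L. G. Valiant, V. V. Vazirani, *Random generation of combinatorial structures from
  a uniform distribution*, Theoret. Comput. Sci. 43 (1986) 169–188, Lemma 6.1 "Powering lemma"
  (p. 182: median of `t = 12⌈−log δ⌉ + 1` runs, Chernoff) [JerrumValiantVazirani1986].
* N.-H. Chia, A. Gilyén, T. Li, H.-H. Lin, E. Tang, C. Wang, J. ACM 69(5):33 (2022)
  = arXiv:1910.06151, §7 "Deferred proofs", proof of Lemma "Inner product estimation"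
  (median of `8 log(1/δ)` means; `exp(−q/8)`) [ChiaEtAl2022].
* Mathlib: `ProbabilityTheory.HasSubgaussianMGF.measure_sum_ge_le_of_iIndepFun`,
  `ProbabilityTheory.hasSubgaussianMGF_of_mem_Icc`, `ProbabilityTheory.iIndepFun_pi`,
  `MeasureTheory.Measure.pi_singleton`, `PMF.toMeasure`.
-/

noncomputable section

namespace Literature.Computability.Complexity

open _root_.MeasureTheory _root_.ProbabilityTheory Finset Real

/-- **Hoeffding, upper tail, `[0,1]`-valued, weighted product form.** Let `w ≥ 0`, `∑ w = 1` be
probability weights on a finite `α` and `F : α → [0,1]` with mean `a = ∑ w·F`. Then the product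
weight of the sequences `ω : Fin m → α` (`m ≥ 1`) with `∑ᵢ F(ωᵢ) ≥ m a + m η` (`η ≥ 0`) is at most
`exp(-2 m η²)`. [cite: Hoeffding1963, Thm. 1 eq. (2.3) and Thm. 2 (`bᵢ − aᵢ = 1`)] -/
theorem sum_weight_upperDeviation_le_exp {α : Type*} [Fintype α] (w : α → ℝ) (hw : ∀ a, 0 ≤ w a)
    (hw1 : ∑ a, w a = 1) (F : α → ℝ) (hF : ∀ a, F a ∈ Set.Icc (0 : ℝ) 1) {m : ℕ} (hm : 0 < m)
    {η : ℝ} (hη : 0 ≤ η) :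
    ∑ ω ∈ univ.filter (fun ω : Fin m → α =>
        (m : ℝ) * η ≤ (∑ i, F (ω i)) - m * (∑ a, w a * F a)), ∏ i, w (ω i)
      ≤ exp (-2 * m * η ^ 2) := by
  classical
  letI : MeasurableSpace α := ⊤
  haveI : MeasurableSingletonClass α := ⟨fun _ => MeasurableSpace.measurableSet_top⟩
  -- one trial: the measure with the weights `w`
  have hsum : ∑ a, ENNReal.ofReal (w a) = 1 := by
    rw [← ENNReal.ofReal_sum_of_nonneg (fun a _ => hw a), hw1, ENNReal.ofReal_one]
  set p : PMF α := PMF.ofFintype (fun a => ENNReal.ofReal (w a)) hsum with hp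
  set μ : Measure α := p.toMeasure with hμ
  have hμa : ∀ a : α, μ {a} = ENNReal.ofReal (w a) := fun a => by
    rw [hμ, p.toMeasure_apply_singleton a (measurableSet_singleton a), hp, PMF.ofFintype_apply]
  set X : α → ℝ := F with hX
  have hXmeas : Measurable X := measurable_of_finite X
  have hXbdd : ∀ᵐ a ∂μ, X a ∈ Set.Icc (0 : ℝ) 1 := ae_of_all _ fun a => hF a
  have hXLp : MemLp X 2 μ := memLp_of_bounded hXbdd hXmeas.aestronglyMeasurable 2
  have hmean : μ[X] = ∑ a, w a * F a := by
    rw [integral_fintype (MemLp.integrable (by norm_num) hXLp)]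
    have hsing : ∀ a : α, μ.real {a} = w a := fun a => by
      rw [measureReal_def, hμa, ENNReal.toReal_ofReal (hw a)]
    simp only [hsing, smul_eq_mul, hX]
  -- Hoeffding's lemma: the centred variable is sub-Gaussian with parameter `1/4`
  have hsg : HasSubgaussianMGF (fun a => X a - μ[X]) ((‖(1 : ℝ) - 0‖₊ / 2) ^ 2) μ :=
    hasSubgaussianMGF_of_mem_Icc hXmeas.aemeasurable hXbdd
  -- `m` independent trials
  set P : Measure (Fin m → α) := Measure.pi fun _ : Fin m => μ with hP
  set Y : Fin m → (Fin m → α) → ℝ := fun i ω => X (ω i) - μ[X] with hY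
  have hind : iIndepFun Y P :=
    iIndepFun_pi (X := fun (_ : Fin m) (a : α) => X a - μ[X]) fun _ =>
      (hXmeas.sub_const _).aemeasurable
  have hsgi : ∀ i ∈ (univ : Finset (Fin m)),
      HasSubgaussianMGF (Y i) ((‖(1 : ℝ) - 0‖₊ / 2) ^ 2) P := by
    intro i _
    exact HasSubgaussianMGF.of_map (μ := P) (Y := fun ω : Fin m → α => ω i)
      (X := fun a => X a - μ[X]) (measurable_pi_apply i).aemeasurable
      (by rw [(measurePreserving_eval (fun _ : Fin m => μ) i).map_eq]; exact hsg)
  have hhoeff := HasSubgaussianMGF.measure_sum_ge_le_of_iIndepFun hind hsgi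
    (ε := (m : ℝ) * η) (by positivity)
  -- identify the sum and the event
  set B : Finset (Fin m → α) := univ.filter fun ω : Fin m → α =>
    (m : ℝ) * η ≤ (∑ i, F (ω i)) - m * (∑ a, w a * F a) with hB
  have hsumY : ∀ ω : Fin m → α, (∑ i : Fin m, Y i ω) = (∑ i, F (ω i)) - m * (∑ a, w a * F a) := by
    intro ω
    simp only [hY, Finset.sum_sub_distrib, Finset.sum_const, Finset.card_univ,
      Fintype.card_fin, nsmul_eq_mul]
    rw [hmean]
  have hBset : (B : Set (Fin m → α)) = {ω | (m : ℝ) * η ≤ ∑ i : Fin m, Y i ω} := by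
    ext ω
    simp only [Finset.coe_filter, Finset.mem_univ, true_and, Set.mem_setOf_eq, hsumY ω, hB]
  have hPB : P.real B ≤ exp (-2 * m * η ^ 2) := by
    rw [hBset]
    refine hhoeff.trans (le_of_eq ?_)
    congr 1
    simp only [Finset.sum_const, Finset.card_univ, Fintype.card_fin, nsmul_eq_mul]
    have : ((‖(1 : ℝ) - 0‖₊ / 2) ^ 2 : NNReal) = (1 / 4 : ℝ) := by
      rw [sub_zero, nnnorm_one]; push_cast; norm_num
    rw [NNReal.coe_mul, this]
    have hm' : (m : ℝ) ≠ 0 := by exact_mod_cast hm.ne'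
    push_cast
    field_simp
    ring
  -- read the product measure of `B` as the product weight
  have hPB' : P B = ENNReal.ofReal (∑ ω ∈ B, ∏ i, w (ω i)) := by
    rw [← sum_measure_singleton, ENNReal.ofReal_sum_of_nonneg
      (fun ω _ => Finset.prod_nonneg fun i _ => hw (ω i))]
    refine Finset.sum_congr rfl fun ω _ => ?_
    rw [hP, Measure.pi_singleton, ENNReal.ofReal_prod_of_nonneg (fun i _ => hw (ω i))]
    exact Finset.prod_congr rfl fun i _ => hμa (ω i)
  have hnn : 0 ≤ ∑ ω ∈ B, ∏ i, w (ω i) :=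
    Finset.sum_nonneg fun ω _ => Finset.prod_nonneg fun i _ => hw (ω i)
  have : P.real B = ∑ ω ∈ B, ∏ i, w (ω i) := by
    rw [measureReal_def, hPB', ENNReal.toReal_ofReal hnn]
  rw [this] at hPB
  exact hPB

/-- **Hoeffding, lower tail, weighted product form**: the product weight of the sequences with
`∑ᵢ F(ωᵢ) ≤ m a - m η` is at most `exp(-2 m η²)` (apply the upper tail to `1 - F`).
[cite: Hoeffding1963, Thm. 2] -/
theorem sum_weight_lowerDeviation_le_exp {α : Type*} [Fintype α] (w : α → ℝ) (hw : ∀ a, 0 ≤ w a)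
    (hw1 : ∑ a, w a = 1) (F : α → ℝ) (hF : ∀ a, F a ∈ Set.Icc (0 : ℝ) 1) {m : ℕ} (hm : 0 < m)
    {η : ℝ} (hη : 0 ≤ η) :
    ∑ ω ∈ univ.filter (fun ω : Fin m → α =>
        (m : ℝ) * η ≤ m * (∑ a, w a * F a) - (∑ i, F (ω i))), ∏ i, w (ω i)
      ≤ exp (-2 * m * η ^ 2) := by
  have hG : ∀ a, 1 - F a ∈ Set.Icc (0 : ℝ) 1 := fun a => by
    have := hF a; simp only [Set.mem_Icc] at this ⊢; constructor <;> linarith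
  have h := sum_weight_upperDeviation_le_exp w hw hw1 (fun a => 1 - F a) hG hm hη
  refine le_trans (le_of_eq (Finset.sum_congr ?_ fun _ _ => rfl)) h
  congr 1
  ext ω
  have e1 : ∑ i : Fin m, (1 - F (ω i)) = m - ∑ i, F (ω i) := by
    rw [Finset.sum_sub_distrib, Finset.sum_const, Finset.card_univ, Fintype.card_fin,
      nsmul_eq_mul, mul_one]
  have e2 : ∑ a, w a * (1 - F a) = 1 - ∑ a, w a * F a := by
    simp only [mul_sub, mul_one, Finset.sum_sub_distrib, hw1]
  simp only [e1, e2]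
  constructor <;> intro h' <;> linarith

/-- **The median trick, counting half.** If the bad outcomes of one trial carry weight at most
`1/4`, then the product weight of the sequences of `q ≥ 1` trials in which at least half the trials
are bad is at most `exp(-q/8)` ("`Pr[(1/q)∑ᵢ Eᵢ ≥ 1/2] ≤ Pr[(1/q)∑ᵢ Eᵢ ≥ 1/4 + E[Eᵢ]] ≤ exp(−q/8)`").
[cite: ChiaEtAl2022, §7, proof of Lemma "Inner product estimation"];
[cite: JerrumValiantVazirani1986, Lemma 6.1 (powering lemma), proof] -/
theorem sum_weight_half_bad_le_exp {α : Type*} [Fintype α] (w : α → ℝ) (hw : ∀ a, 0 ≤ w a)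
    (hw1 : ∑ a, w a = 1) (bad : α → Prop) [DecidablePred bad]
    (hbad : ∑ a ∈ univ.filter bad, w a ≤ 1 / 4) {q : ℕ} (hq : 0 < q) :
    ∑ ω ∈ univ.filter (fun ω : Fin q → α => q ≤ 2 * (univ.filter fun i => bad (ω i)).card),
        ∏ i, w (ω i) ≤ exp (-(q : ℝ) / 8) := by
  classical
  set F : α → ℝ := fun a => if bad a then 1 else 0 with hF
  have hF01 : ∀ a, F a ∈ Set.Icc (0 : ℝ) 1 := fun a => by
    simp only [hF]; split_ifs <;> simp
  have hmeanle : ∑ a, w a * F a ≤ 1 / 4 := by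
    have e : ∑ a : α, w a * F a = ∑ a ∈ univ.filter bad, w a := by
      rw [Finset.sum_filter]
      exact Finset.sum_congr rfl fun a _ => by simp only [hF]; split_ifs <;> simp
    rw [e]; exact hbad
  have h := sum_weight_upperDeviation_le_exp w hw hw1 F hF01 hq (η := 1 / 4) (by norm_num)
  have hexp : exp (-2 * (q : ℝ) * (1 / 4) ^ 2) = exp (-(q : ℝ) / 8) := by
    congr 1; ring
  rw [hexp] at h
  refine le_trans (Finset.sum_le_sum_of_subset_of_nonneg ?_ fun ω _ _ =>
    Finset.prod_nonneg fun i _ => hw (ω i)) h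
  intro ω hω
  simp only [Finset.mem_filter, Finset.mem_univ, true_and] at hω ⊢
  have hcount : (∑ i : Fin q, F (ω i)) = ((univ.filter fun i => bad (ω i)).card : ℝ) := by
    rw [Finset.natCast_card_filter]
  rw [hcount]
  have h2 : (q : ℝ) ≤ 2 * ((univ.filter fun i => bad (ω i)).card : ℝ) := by exact_mod_cast hω
  nlinarith [hmeanle, h2]

/-! ### Medians -/

/-- `c` is a median of the finite family `v`: at most half the values lie strictly below `c` and
at most half strictly above (`2·#{i : v i < c} ≤ q` and `2·#{i : c < v i} ≤ q`) — "M then outputs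
the median of the t results". [cite: JerrumValiantVazirani1986, Lemma 6.1 (proof)] -/
def IsMedian {q : ℕ} (v : Fin q → ℝ) (c : ℝ) : Prop :=
  2 * (univ.filter fun i => v i < c).card ≤ q ∧ 2 * (univ.filter fun i => c < v i).card ≤ q

namespace IsMedian

variable {q : ℕ} {v : Fin q → ℝ} {c : ℝ}

/-- **Key observation of the median trick**: if a median `c` of `v` is at distance `≥ a` from `μ`,
then at least half of the `v i` are at distance `≥ a` from `μ` ("if `|Re(Z̃ − E[Z])| ≥ ε/√2`, then at
least half of the `Z̄`'s satisfy `|Re(Z̄ − E[Z])| ≥ ε/√2`").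
[cite: ChiaEtAl2022, §7, proof of Lemma "Inner product estimation"] -/
theorem le_two_mul_card_far (h : IsMedian v c) {μ a : ℝ} (hfar : a ≤ |c - μ|) :
    q ≤ 2 * (univ.filter fun i => a ≤ |v i - μ|).card := by
  classical
  rcases le_or_gt 0 (c - μ) with hc | hc
  · -- `c ≥ μ + a`: every `i` with `v i ≥ c` is far; these are all but `#{v i < c} ≤ q/2`
    rw [abs_of_nonneg hc] at hfar
    have hsub : (univ.filter fun i => ¬ v i < c) ⊆ (univ.filter fun i => a ≤ |v i - μ|) := by
      intro i hi
      simp only [Finset.mem_filter, Finset.mem_univ, true_and, not_lt] at hi ⊢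
      rw [abs_of_nonneg (by linarith)]; linarith
    have hcard := Finset.card_le_card hsub
    have hsplit := Finset.card_filter_add_card_filter_not (s := (univ : Finset (Fin q)))
      (fun i => v i < c)
    rw [Finset.card_univ, Fintype.card_fin] at hsplit
    have h1 := h.1
    omega
  · rw [abs_of_neg hc] at hfar
    have hsub : (univ.filter fun i => ¬ c < v i) ⊆ (univ.filter fun i => a ≤ |v i - μ|) := by
      intro i hi
      simp only [Finset.mem_filter, Finset.mem_univ, true_and, not_lt] at hi ⊢
      rw [abs_of_nonpos (by linarith)]; linarith
    have hcard := Finset.card_le_card hsub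
    have hsplit := Finset.card_filter_add_card_filter_not (s := (univ : Finset (Fin q)))
      (fun i => c < v i)
    rw [Finset.card_univ, Fintype.card_fin] at hsplit
    have h2 := h.2
    omega

end IsMedian

/-- A median always exists among the values (`q ≥ 1`): the least value `v i` such that at least
half of the family is `≤ v i`. [cite: JerrumValiantVazirani1986, Lemma 6.1 (the median of the `t`
results)] -/
theorem exists_isMedian {q : ℕ} (hq : 0 < q) (v : Fin q → ℝ) : ∃ i, IsMedian v (v i) := by
  classical
  -- candidates: indices whose value has at least half the family below-or-equal
  set S : Finset (Fin q) := univ.filter fun i => q ≤ 2 * (univ.filter fun j => v j ≤ v i).card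
    with hS
  -- the maximum is a candidate, so `S` is nonempty
  haveI : Nonempty (Fin q) := ⟨⟨0, hq⟩⟩
  obtain ⟨imax, -, hmax⟩ := Finset.exists_max_image (univ : Finset (Fin q)) v univ_nonempty
  have hSne : S.Nonempty := by
    refine ⟨imax, ?_⟩
    simp only [hS, Finset.mem_filter, Finset.mem_univ, true_and]
    have : (univ.filter fun j => v j ≤ v imax) = univ :=
      Finset.filter_true_of_mem fun j hj => hmax j hj
    rw [this, Finset.card_univ, Fintype.card_fin]; omega
  -- take a candidate with the least value
  obtain ⟨i, hiS, hmin⟩ := Finset.exists_min_image S v hSne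
  refine ⟨i, ?_, ?_⟩
  · -- `#{v j < v i} ≤ q/2`: if nonempty, its largest element `j*` is not a candidate, and
    -- `{v j < v i} ⊆ {v j ≤ v j*}`
    by_cases hne : (univ.filter fun j => v j < v i).Nonempty
    · obtain ⟨jm, hjm, hjmax⟩ := Finset.exists_max_image _ v hne
      simp only [Finset.mem_filter, Finset.mem_univ, true_and] at hjm
      have hnot : jm ∉ S := by
        intro hj
        have := hmin jm hj
        linarith
      simp only [hS, Finset.mem_filter, Finset.mem_univ, true_and, not_le] at hnot
      have hsub : (univ.filter fun j => v j < v i) ⊆ (univ.filter fun j => v j ≤ v jm) := by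
        intro j hj
        simp only [Finset.mem_filter, Finset.mem_univ, true_and] at hj ⊢
        exact hjmax j (by simp [hj])
      have := Finset.card_le_card hsub
      omega
    · rw [Finset.not_nonempty_iff_eq_empty] at hne
      rw [hne, Finset.card_empty]; omega
  · -- `#{v i < v j} = q - #{v j ≤ v i} ≤ q/2` since `i` is a candidate
    simp only [hS, Finset.mem_filter, Finset.mem_univ, true_and] at hiS
    have hsplit := Finset.card_filter_add_card_filter_not (s := (univ : Finset (Fin q)))
      (fun j => v j ≤ v i)
    rw [Finset.card_univ, Fintype.card_fin] at hsplit
    have e : (univ.filter fun j => ¬ v j ≤ v i) = (univ.filter fun j => v i < v j) := by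
      ext j; simp [not_le]
    rw [e] at hsplit
    omega

/-- **Median of means / median trick, weighted form.** If the outcomes of one trial whose value
`Z` is at distance `≥ a` from `μ` have weight `≤ 1/4`, then for `q ≥ 1` independent trials the
product weight of the sequences whose median value (ANY median selector) is at distance `≥ a` from
`μ` is at most `exp(−q/8)` — Jerrum–Valiant–Vazirani's powering lemma with the Hoeffding constant
of Chia et al. [cite: JerrumValiantVazirani1986, Lemma 6.1];
[cite: ChiaEtAl2022, §7, proof of Lemma "Inner product estimation" (`exp(−q/8) ≤ δ/2`)] -/
theorem sum_weight_median_far_le_exp {α : Type*} [Fintype α] (w : α → ℝ) (hw : ∀ a, 0 ≤ w a)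
    (hw1 : ∑ a, w a = 1) (Z : α → ℝ) (μ a : ℝ)
    (hbad : ∑ x ∈ univ.filter (fun x => a ≤ |Z x - μ|), w x ≤ 1 / 4) {q : ℕ} (hq : 0 < q)
    (med : (Fin q → α) → ℝ) (hmed : ∀ ω, IsMedian (fun i => Z (ω i)) (med ω)) :
    ∑ ω ∈ univ.filter (fun ω : Fin q → α => a ≤ |med ω - μ|), ∏ i, w (ω i)
      ≤ exp (-(q : ℝ) / 8) := by
  classical
  refine le_trans (Finset.sum_le_sum_of_subset_of_nonneg ?_ fun ω _ _ =>
    Finset.prod_nonneg fun i _ => hw (ω i))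
    (sum_weight_half_bad_le_exp w hw hw1 (fun x => a ≤ |Z x - μ|) hbad hq)
  intro ω hω
  simp only [Finset.mem_filter, Finset.mem_univ, true_and] at hω ⊢
  exact (hmed ω).le_two_mul_card_far hω

/-- The sample-count form: `exp(−q/8) ≤ δ` as soon as `8 ln(1/δ) ≤ q` (`0 < δ`) — "the median of
`y := 8 log(1/δ)` independent copies". [cite: ChiaEtAl2022, §7, proof of Lemma "Inner product
estimation"] -/
theorem exp_neg_div_eight_le {q : ℕ} {δ : ℝ} (hδ : 0 < δ) (hq : 8 * Real.log (1 / δ) ≤ q) :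
    exp (-(q : ℝ) / 8) ≤ δ := by
  rw [Real.log_div (by norm_num) hδ.ne', Real.log_one, zero_sub] at hq
  have : -(q : ℝ) / 8 ≤ Real.log δ := by linarith
  calc exp (-(q : ℝ) / 8) ≤ exp (Real.log δ) := exp_le_exp.2 this
    _ = δ := Real.exp_log hδ

end Literature.Computability.Complexity

end
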